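import Summits.HubbardSuperconductivity.HubbardSuperconductivity.Theorems.AnisotropyChordTransferFibre3N1RowJUFactorProofsB

/-!
# Route `AnisotropyChord` / H0 rotor rung: PORT PartN41-F — `N1RowJUFactor`, PROOFS (3/3): the object splits (S), ★ `n1RowJUFactor_holds`, `trialGapFromReduced_holds`, `fsrClosures_holds`

Port (verbatim; split into ≤ 400-line proof files per the tree lint) of §6 of the theory seat's file
`hubbard-h0-rotor-theory-1/cycle23/lean/PartN41F.lean` (sha16 `3f6ed68bc89a1b85`; theory-1 g23 RESULT 2, memo 23 §350):
theory's own proofs, rc 0, no sorry; statements in `…Fibre3N1RowJUFactor`.  Ported by prover seat `hubbard-h0-rotor-p1` g29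
(route lead); `--supports stmt-HubbardSuperconductivity-23918`.  WHAT THIS IS NOT: nothing here proves superconductivity in the
Hubbard model; identities of ONE row of ONE conditional reduction (piece A of the H0-rotor rung).
-/

set_option linter.dupNamespace false
set_option autoImplicit false

noncomputable section

open scoped BigOperators
open Complex Finset

namespace Summit.HubbardSuperconductivity.HubbardSuperconductivity.Theorems.AnisotropyChord.Transfer.Fibre3

namespace N41F

variable (L : ℕ) [NeZero L]

/-! ### ★ The object splits (S): `ObjectsNuSplit` holds -/

section ObjectSplits

variable {L}

/-- `|z|²`-constraint of a phase in components. -/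
theorem zPh_re_sq_add_im_sq (k e : Tor L) : (zPh L k e).re ^ 2 + (zPh L k e).im ^ 2 = 1 := by
  unfold zPh
  rw [Complex.conj_re, Complex.conj_im, neg_sq]
  exact OuterMaj.phase_re_sq_add_im_sq L k e

/-- the `Q` integrand, expanded: `|a²z + λs|²(j + λS) = a⁴j + λ[2a²Re(z̄s)j + a⁴S + λ(|s|²j + 2a²Re(z̄s)S) + λ²|s|²S]`. -/
theorem q_integrand (a2 lam j S : ℝ) (z s : ℂ) (hz : z.re ^ 2 + z.im ^ 2 = 1) :
    Complex.normSq (((a2 : ℝ) : ℂ) * z + (lam : ℂ) * s) * (j + lam * S)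
      = a2 ^ 2 * j + lam * (2 * a2 * ((starRingEnd ℂ) z * s).re * j + a2 ^ 2 * S
          + lam * (Complex.normSq s * j + 2 * a2 * ((starRingEnd ℂ) z * s).re * S)
          + lam ^ 2 * (Complex.normSq s * S)) := by
  rw [Complex.normSq_apply, Complex.normSq_apply]
  simp only [Complex.add_re, Complex.add_im, Complex.mul_re, Complex.mul_im, Complex.ofReal_re, Complex.ofReal_im,
    Complex.conj_re, Complex.conj_im, zero_mul, sub_zero, add_zero]
  linear_combination (a2 ^ 2 * (j + lam * S)) * hz

/-- the `B_C` integrand, expanded (`z₀,z₁` unimodular phases, `s₀,s₁` the reduced slots, `F = j + λS`). -/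
theorem bc_integrand (a2 lam j0 j1 S0 S1 : ℝ) (z0 z1 s0 s1 : ℂ) (hz : z0.re ^ 2 + z0.im ^ 2 = 1) :
    ((starRingEnd ℂ) (((a2 : ℝ) : ℂ) * z0 + (lam : ℂ) * s0) * (((a2 : ℝ) : ℂ) * z1 + (lam : ℂ) * s1)).re
        * ((j0 + lam * S0) + (j1 + lam * S1))
      + Complex.normSq (((a2 : ℝ) : ℂ) * z0 + (lam : ℂ) * s0) * (j1 + lam * S1)
      = (a2 ^ 2 * ((starRingEnd ℂ) z0 * z1).re * (j0 + j1) + a2 ^ 2 * j1)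
        + lam * (a2 ^ 2 * ((starRingEnd ℂ) z0 * z1).re * (S0 + S1)
                  + a2 * ((starRingEnd ℂ) z0 * s1 + (starRingEnd ℂ) s0 * z1).re * (j0 + j1)
                  + a2 ^ 2 * S1 + 2 * a2 * ((starRingEnd ℂ) z0 * s0).re * j1)
        + lam ^ 2 * (a2 * ((starRingEnd ℂ) z0 * s1 + (starRingEnd ℂ) s0 * z1).re * (S0 + S1)
                  + ((starRingEnd ℂ) s0 * s1).re * (j0 + j1)
                  + 2 * a2 * ((starRingEnd ℂ) z0 * s0).re * S1 + Complex.normSq s0 * j1)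
        + lam ^ 3 * (((starRingEnd ℂ) s0 * s1).re * (S0 + S1) + Complex.normSq s0 * S1) := by
  rw [Complex.normSq_apply, Complex.normSq_apply]
  simp only [Complex.add_re, Complex.add_im, Complex.mul_re, Complex.mul_im, Complex.ofReal_re, Complex.ofReal_im,
    Complex.conj_re, Complex.conj_im, zero_mul, sub_zero, add_zero, map_add, map_mul, Complex.conj_ofReal]
  linear_combination (a2 ^ 2 * (j1 + lam * S1)) * hz

variable (L)

/-- (S) for `P`, `A`, `B`. -/
theorem objectsNuSplit_PAB {Δ lam2 : ℝ} {f : Tor L → ℝ} (hL : 5 ≤ L) (hΔ0 : 0 ≤ Δ) (hΔ1 : Δ < 1)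
    (hf : IsGroundTwoMagnon L Δ lam2 f) :
    PiNormSq L f = PJU L Δ f + lam2 * PSr L Δ lam2 f ∧
    Axhat L f = AJU L Δ f + lam2 * ASr L Δ lam2 f ∧
    Bterm L f = BJU L Δ f + lam2 * BSr L Δ lam2 f := by
  have hev : ∀ r : Tor L, f (-r) = f r := hf.2.1
  have hF := f2NuSplit_holds L Δ lam2 f hL hΔ0 hΔ1 hf
  obtain ⟨hJ1, hJ2, hJ3, -, -, -, -⟩ := juClosedSums_holds L Δ f (by omega)
  refine ⟨?_, ?_, ?_⟩
  · rw [piNormOneLoop_holds L f hev, ← hJ1]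
    unfold PSr
    have h : ∀ k : Tor L, F2 L f k ^ 3 = jK L Δ f k ^ 3
        + lam2 * (3 * jK L Δ f k ^ 2 * FSr L Δ lam2 f k + lam2 * (3 * jK L Δ f k * FSr L Δ lam2 f k ^ 2)
            + lam2 ^ 2 * FSr L Δ lam2 f k ^ 3) := by
      intro k; rw [hF k]; ring
    rw [Finset.sum_congr rfl (fun k _ => h k), Finset.sum_add_distrib, ← Finset.mul_sum]
    ring
  · rw [axhatOneLoop_holds L f hev, ← hJ2]
    unfold ASr
    have h : ∀ k : Tor L, F2 L f k ^ 2 * Real.cos (2 * Real.pi * k.1.val / L)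
        = jK L Δ f k ^ 2 * Real.cos (2 * Real.pi * k.1.val / L)
          + lam2 * ((2 * jK L Δ f k * FSr L Δ lam2 f k + lam2 * FSr L Δ lam2 f k ^ 2)
              * Real.cos (2 * Real.pi * k.1.val / L)) := by
      intro k; rw [hF k]; ring
    rw [Finset.sum_congr rfl (fun k _ => h k), Finset.sum_add_distrib, ← Finset.mul_sum]
    ring
  · rw [btermOneLoop_holds L f hev, ← hJ3]
    unfold BSr
    have h : ∀ k : Tor L, F2 L f k ^ 2 * F2 L f (k + K1 L)
        = jK L Δ f k ^ 2 * jK L Δ f (k + K1 L)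
          + lam2 * (2 * jK L Δ f k * jK L Δ f (k + K1 L) * FSr L Δ lam2 f k + jK L Δ f k ^ 2 * FSr L Δ lam2 f (k + K1 L)
              + lam2 * (FSr L Δ lam2 f k ^ 2 * jK L Δ f (k + K1 L)
                  + 2 * jK L Δ f k * FSr L Δ lam2 f k * FSr L Δ lam2 f (k + K1 L))
              + lam2 ^ 2 * (FSr L Δ lam2 f k ^ 2 * FSr L Δ lam2 f (k + K1 L))) := by
      intro k; rw [hF k, hF (k + K1 L)]; ring
    rw [Finset.sum_congr rfl (fun k _ => h k), Finset.sum_add_distrib, ← Finset.mul_sum]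
    ring

end ObjectSplits

section ObjectSplits2

omit [NeZero L] in
/-- membership of the four neighbours in `nnList`. -/
theorem ex_mem_nnList' : ex L ∈ nnList L ∧ -ex L ∈ nnList L ∧ ey L ∈ nnList L ∧ -ey L ∈ nnList L := by
  unfold nnList ex ey
  refine ⟨by simp, by simp, by simp, by simp⟩

/-- `Re(conj(z_k) z_{k+K₁}) = Re φ(K₁, e)` for the conjugate phases `z = zPh`. -/
theorem zPh_conj_mul_shift_re (k e : Tor L) :
    ((starRingEnd ℂ) (zPh L k e) * zPh L (k + K1 L) e).re = (phase L (K1 L) e).re := by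
  unfold zPh
  rw [Complex.conj_conj]
  exact OuterMaj.re_phase_mul_conj_shift L k e

/-- (S) for `Q = Σ_c Π⁰C0`. -/
theorem objectsNuSplit_Q {Δ lam2 : ℝ} {f : Tor L → ℝ} (hL : 5 ≤ L) (hΔ0 : 0 ≤ Δ) (hΔ1 : Δ < 1)
    (hf : IsGroundTwoMagnon L Δ lam2 f) :
    (∑ c : Cfg L, piR L f c * C0fn L Δ lam2 f c) = lam2 * (QJUr L Δ lam2 f + QSr L Δ lam2 f) := by
  have hev : ∀ r : Tor L, f (-r) = f r := hf.2.1
  have hΦ := phiHatNuSplit_holds L Δ lam2 f hL hΔ0 hΔ1 hf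
  have hF := f2NuSplit_holds L Δ lam2 f hL hΔ0 hΔ1 hf
  obtain ⟨-, -, -, hJ4, -, hσ1, -⟩ := juClosedSums_holds L Δ f (by omega)
  obtain ⟨-, -, hsig, -, -⟩ := dictionaryNu_holds L Δ lam2 f hL hΔ0 hΔ1 hf
  obtain ⟨hx, hnx, hy, hny⟩ := ex_mem_nnList' L
  rw [piC0OneLoop_holds L Δ lam2 f hf.1 hev]
  -- per-e identity
  have he : ∀ e ∈ nnList L,
      (∑ k : Tor L, Complex.normSq (phiHat L f e k) * F2 L f k) / (L : ℝ) ^ 2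
        = aPar L Δ f ^ 4 * (bPar L Δ f ^ 2 - aPar L Δ f ^ 2)
          + lam2 * ((∑ k : Tor L,
              (2 * aPar L Δ f ^ 2 * ((starRingEnd ℂ) (zPh L k e) * phiSr L Δ lam2 f e k).re * jK L Δ f k
                + aPar L Δ f ^ 4 * FSr L Δ lam2 f k
                + lam2 * (Complex.normSq (phiSr L Δ lam2 f e k) * jK L Δ f k
                    + 2 * aPar L Δ f ^ 2 * ((starRingEnd ℂ) (zPh L k e) * phiSr L Δ lam2 f e k).re * FSr L Δ lam2 f k)
                + lam2 ^ 2 * (Complex.normSq (phiSr L Δ lam2 f e k) * FSr L Δ lam2 f k))) / (L : ℝ) ^ 2) := by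
    intro e he
    have h : ∀ k : Tor L, Complex.normSq (phiHat L f e k) * F2 L f k
        = aPar L Δ f ^ 4 * jK L Δ f k
          + lam2 * (2 * aPar L Δ f ^ 2 * ((starRingEnd ℂ) (zPh L k e) * phiSr L Δ lam2 f e k).re * jK L Δ f k
                + aPar L Δ f ^ 4 * FSr L Δ lam2 f k
                + lam2 * (Complex.normSq (phiSr L Δ lam2 f e k) * jK L Δ f k
                    + 2 * aPar L Δ f ^ 2 * ((starRingEnd ℂ) (zPh L k e) * phiSr L Δ lam2 f e k).re * FSr L Δ lam2 f k)
                + lam2 ^ 2 * (Complex.normSq (phiSr L Δ lam2 f e k) * FSr L Δ lam2 f k)) := by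
      intro k
      rw [hΦ e he k, hF k, q_integrand _ _ _ _ _ _ (zPh_re_sq_add_im_sq k e)]
      ring
    rw [Finset.sum_congr rfl (fun k _ => h k), Finset.sum_add_distrib, ← Finset.mul_sum, ← Finset.mul_sum, add_div,
      mul_div_assoc, hJ4]
    ring
  unfold QSr
  rw [nnList_map_sum, nnList_map_sum, he _ hx, he _ hnx, he _ hy, he _ hny]
  unfold QJUr
  linear_combination (-(6 * aPar L Δ f ^ 4)) * hσ1 + (-(6 * aPar L Δ f ^ 4 * (aPar L Δ f + bPar L Δ f))) * hsig

/-- (S) for `B_C`. -/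
theorem objectsNuSplit_BC {Δ lam2 : ℝ} {f : Tor L → ℝ} (hL : 5 ≤ L) (hΔ0 : 0 ≤ Δ) (hΔ1 : Δ < 1)
    (hf : IsGroundTwoMagnon L Δ lam2 f) :
    BCterm L Δ lam2 f = lam2 * (BCJUr L Δ lam2 f + BCSr L Δ lam2 f) := by
  have hev : ∀ r : Tor L, f (-r) = f r := hf.2.1
  have hΦ := phiHatNuSplit_holds L Δ lam2 f hL hΔ0 hΔ1 hf
  have hF := f2NuSplit_holds L Δ lam2 f hL hΔ0 hΔ1 hf
  obtain ⟨-, -, -, hJ4, -, hσ1, -⟩ := juClosedSums_holds L Δ f (by omega)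
  obtain ⟨-, -, hsig, -, -⟩ := dictionaryNu_holds L Δ lam2 f hL hΔ0 hΔ1 hf
  obtain ⟨hx, hnx, hy, hny⟩ := ex_mem_nnList' L
  rw [bcOneLoop_holds L Δ lam2 f hf.1 hev]
  -- per-e identity, with the `k`-independent phase `c_e = Re φ(K₁,e)`
  have he : ∀ e ∈ nnList L,
      (∑ k : Tor L, (((starRingEnd ℂ) (phiHat L f e k) * phiHat L f e (k + K1 L)).re * (F2 L f k + F2 L f (k + K1 L))
          + Complex.normSq (phiHat L f e k) * F2 L f (k + K1 L))) / (L : ℝ) ^ 2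
        = aPar L Δ f ^ 4 * (2 * (phase L (K1 L) e).re + 1) * (bPar L Δ f ^ 2 - aPar L Δ f ^ 2)
          + lam2 * ((∑ k : Tor L, (bcDeg1 L Δ lam2 f e k + lam2 * bcDeg2 L Δ lam2 f e k
              + lam2 ^ 2 * bcDeg3 L Δ lam2 f e k)) / (L : ℝ) ^ 2) := by
    intro e he
    have h : ∀ k : Tor L,
        ((starRingEnd ℂ) (phiHat L f e k) * phiHat L f e (k + K1 L)).re * (F2 L f k + F2 L f (k + K1 L))
          + Complex.normSq (phiHat L f e k) * F2 L f (k + K1 L)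
        = (aPar L Δ f ^ 4 * ((starRingEnd ℂ) (zPh L k e) * zPh L (k + K1 L) e).re * (jK L Δ f k + jK L Δ f (k + K1 L))
            + aPar L Δ f ^ 4 * jK L Δ f (k + K1 L))
          + lam2 * (bcDeg1 L Δ lam2 f e k + lam2 * bcDeg2 L Δ lam2 f e k + lam2 ^ 2 * bcDeg3 L Δ lam2 f e k) := by
      intro k
      rw [hΦ e he k, hΦ e he (k + K1 L), hF k, hF (k + K1 L),
        bc_integrand _ _ _ _ _ _ _ _ _ _ (zPh_re_sq_add_im_sq k e)]
      unfold bcDeg1 bcDeg2 bcDeg3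
      ring
    have h0 : ∀ k : Tor L,
        aPar L Δ f ^ 4 * ((starRingEnd ℂ) (zPh L k e) * zPh L (k + K1 L) e).re * (jK L Δ f k + jK L Δ f (k + K1 L))
            + aPar L Δ f ^ 4 * jK L Δ f (k + K1 L)
          = aPar L Δ f ^ 4 * (phase L (K1 L) e).re * jK L Δ f k
            + aPar L Δ f ^ 4 * ((phase L (K1 L) e).re + 1) * jK L Δ f (k + K1 L) := by
      intro k; rw [zPh_conj_mul_shift_re]; ring
    have hshift : ∑ k : Tor L, jK L Δ f (k + K1 L) = ∑ k : Tor L, jK L Δ f k := ClosedExp.sum_shift_K1 L _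
    rw [Finset.sum_congr rfl (fun k _ => h k), Finset.sum_add_distrib, ← Finset.mul_sum,
      Finset.sum_congr rfl (fun k _ => h0 k), Finset.sum_add_distrib, ← Finset.mul_sum, ← Finset.mul_sum, hshift,
      add_div, ← hJ4]
    ring
  have hcx : (phase L (K1 L) (ex L)).re = 1 - eps1 L := OuterMaj.phase_K1_ex_re L
  have hcnx : (phase L (K1 L) (-ex L)).re = 1 - eps1 L := by rw [phase_re_neg]; exact hcx
  have hcy : (phase L (K1 L) (ey L)).re = 1 := by rw [(phase_K1_ey L).1, Complex.one_re]
  have hcny : (phase L (K1 L) (-ey L)).re = 1 := by rw [(phase_K1_ey L).2, Complex.one_re]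
  unfold BCSr
  rw [nnList_map_sum, nnList_map_sum, he _ hx, he _ hnx, he _ hy, he _ hny, hcx, hcnx, hcy, hcny]
  unfold BCJUr eps1
  linear_combination (-(12 * aPar L Δ f ^ 4 * (2 + Real.cos (2 * Real.pi / L)))) * hσ1
    + (-(12 * aPar L Δ f ^ 4 * (2 + Real.cos (2 * Real.pi / L)) * (aPar L Δ f + bPar L Δ f))) * hsig

/-- ★ `ObjectsNuSplit` holds. -/
theorem objectsNuSplit_holds (Δ : ℝ) : ObjectsNuSplit L Δ := by
  intro lam2 f hL hΔ0 hΔ1 hf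
  obtain ⟨hP, hA, hB⟩ := objectsNuSplit_PAB L hL hΔ0 hΔ1 hf
  exact ⟨hP, hA, hB, objectsNuSplit_Q L hL hΔ0 hΔ1 hf, objectsNuSplit_BC L hL hΔ0 hΔ1 hf⟩

/-- ★★ `N1RowJUFactor` holds (unconditionally: `ν` factors out of `N₁` and `U` exactly). -/
theorem n1RowJUFactor_holds (Δ : ℝ) : N1RowJUFactor L Δ :=
  n1RowJUFactor_of_objects L Δ (objectsNuSplit_holds L Δ)

/-- ★★ hence `TrialGapFromReduced`: on the window `N₁ ≥ c·U ⟺ N1red ≥ c·Ured` (the `ν`-free certificate target). -/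
theorem trialGapFromReduced_holds (Δ c : ℝ) : TrialGapFromReduced L Δ c :=
  trialGapFromReduced_of_factor L Δ c (n1RowJUFactor_holds L Δ)

end ObjectSplits2

section Closures

/-- ★ `FSrClosures` holds (Parseval / Fourier inversion + the dictionary). -/
theorem fsrClosures_holds (Δ : ℝ) : FSrClosures L Δ := by
  intro lam2 f hL hΔ0 hΔ1 hf
  obtain ⟨-, hcS, hsig, -, -⟩ := dictionaryNu_holds L Δ lam2 f hL hΔ0 hΔ1 hf
  have hL0 : (L : ℝ) ≠ 0 := by exact_mod_cast NeZero.ne L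
  have hGev : ∀ r : Tor L, (fun r => Gres L lam2 r ^ 2) (-r) = (fun r => Gres L lam2 r ^ 2) r := by
    intro r; simp only [Gres_neg]
  -- `Σ_k g(k) = V·G̃(0)`, `Σ_k g(k) cos(k·x̂) = V·G̃(x̂)`
  have hG0 : ∑ k : Tor L, gres L lam2 k = (L : ℝ) ^ 2 * Gres L lam2 0 := by
    unfold Gres; simp_rw [phase_zero, Complex.one_re, mul_one]; field_simp
  have hG1 : ∑ k : Tor L, gres L lam2 k * Real.cos (2 * Real.pi * k.1.val / L) = (L : ℝ) ^ 2 * Gres L lam2 (K1 L) := by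
    unfold Gres; rw [show K1 L = ex L from rfl]; simp_rw [phase_ex_re]; field_simp
  -- `Σ_k T₂(k) = V·G̃(0)²`, `Σ_k T₂(k) cos(k·x̂) = V·G̃(x̂)²`
  have hT0 : ∑ k : Tor L, T2fun L lam2 k = (L : ℝ) ^ 2 * Gres L lam2 0 ^ 2 := by
    unfold T2fun
    rw [← Complex.re_sum, sum_dft]
    have : ((L : ℂ) ^ 2) * (((fun r => Gres L lam2 r ^ 2) 0 : ℝ) : ℂ) = ((((L : ℝ) ^ 2 * Gres L lam2 0 ^ 2 : ℝ)) : ℂ) := by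
      push_cast; ring
    rw [this, Complex.ofReal_re]
  have hT1 : ∑ k : Tor L, T2fun L lam2 k * Real.cos (2 * Real.pi * k.1.val / L) = (L : ℝ) ^ 2 * Gres L lam2 (K1 L) ^ 2 := by
    have hinv := dft_inversion L (fun r => Gres L lam2 r ^ 2) (K1 L)
    have hk : ∀ k : Tor L, dft L (fun r => Gres L lam2 r ^ 2) k * phase L k (K1 L)
        = ((T2fun L lam2 k : ℝ) : ℂ) * phase L k (ex L) := by
      intro k; rw [dft_even_eq_re L hGev k]; rfl
    rw [Finset.sum_congr rfl fun k _ => hk k,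
      show ((L : ℂ) ^ 2) * (((fun r => Gres L lam2 r ^ 2) (K1 L) : ℝ) : ℂ)
        = ((((L : ℝ) ^ 2 * Gres L lam2 (K1 L) ^ 2 : ℝ)) : ℂ) by push_cast; ring] at hinv
    have hre := congrArg Complex.re hinv
    rw [Complex.ofReal_re, Complex.re_sum] at hre
    rw [← hre]
    refine Finset.sum_congr rfl fun k _ => ?_
    rw [Complex.re_ofReal_mul, phase_ex_re]
  -- `s(x̂) = 1 − f(x̂) = c_s G̃(x̂) − a/V`
  have hsg := sfun'_eq_green L hL hΔ0 hΔ1 hf (K1 L)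
  have hsx : sfun' L Δ f (K1 L) = 1 - f (K1 L) := by
    unfold sfun'; rw [if_neg (K1_ne_zero L (by omega))]
  rw [hsx] at hsg
  constructor
  · have h : ∀ k : Tor L, FSr L Δ lam2 f k
        = (-2 * bPar L Δ f * ((L : ℝ) ^ 2 + aPar L Δ f)) * gres L lam2 k
          + (lam2 * ((L : ℝ) ^ 2 + aPar L Δ f) ^ 2) * T2fun L lam2 k := by
      intro k; unfold FSr; ring
    rw [Finset.sum_congr rfl fun k _ => h k, Finset.sum_add_distrib, ← Finset.mul_sum, ← Finset.mul_sum, hG0, hT0]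
    unfold sigPar at hsig
    unfold bPar
    linear_combination (-((L : ℝ) ^ 2 * ((L : ℝ) ^ 2 + aPar L Δ f) * Gres L lam2 0)) * hsig
  · have h : ∀ k : Tor L, FSr L Δ lam2 f k * Real.cos (2 * Real.pi * k.1.val / L)
        = (-2 * bPar L Δ f * ((L : ℝ) ^ 2 + aPar L Δ f)) * (gres L lam2 k * Real.cos (2 * Real.pi * k.1.val / L))
          + (lam2 * ((L : ℝ) ^ 2 + aPar L Δ f) ^ 2) * (T2fun L lam2 k * Real.cos (2 * Real.pi * k.1.val / L)) := by
      intro k; unfold FSr; ring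
    rw [Finset.sum_congr rfl fun k _ => h k, Finset.sum_add_distrib, ← Finset.mul_sum, ← Finset.mul_sum, hG1, hT1]
    unfold bPar
    linear_combination (-((L : ℝ) ^ 2 * ((L : ℝ) ^ 2 + aPar L Δ f) * Gres L lam2 (K1 L) ^ 2)) * hcS
      + (-((L : ℝ) ^ 2 * ((L : ℝ) ^ 2 + aPar L Δ f) * Gres L lam2 (K1 L))) * hsg

end Closures


end N41F

end Summit.HubbardSuperconductivity.HubbardSuperconductivity.Theorems.AnisotropyChord.Transfer.Fibre3

end
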